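import Mathlib
import HarnessLib
import HarnessLib.Audit
import Summits.RiemannHypothesis.Statement
import Summits.RiemannHypothesis.RiemannHypothesis.Theorems.IntegerScrewSmoothSectorDefs
import HarnessLib.Audit.Status.Attr

/-!
Route: SmoothSectorHardy

CLOSED (proved) 2026-08-29T23:18:34Z by operator:999:1248457 — reason: proved:Summit.RiemannHypothesis.RiemannHypothesis.Theorems.ScrewLemmaKCoprofile.screwSmoothSectorKSharp — note: census g0 batch2 (D-0173/D-0174): proved (leaf K# certified; own binders all proved); reader census-reader-24-g0; evidence verified read-only by gate8 helper 2026-08-29. The file is kept as the record of this route; refuted decls are indexed as negative knowledge (`ledger negatives`).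

# Route SmoothSectorHardy — LEMMA K-sharp (kappa >= pi^2 - 1) by Muntz-Mellin transfer and
three-point Hardy-space interpolation with outer factor zeta(2+w)

RUNG ROUTE (D-0061; D-0145 ideator line, seat rh-idea-6, technique card SPECTRAL / TRACE METHODS):
it suffices to show X = K1a ∧ K1b ∧ K2, three RH-FREE statements of real/complex analysis on the
zero-free half-plane σ ≥ 3/2, to close the registered rung leaf
`IntegerScrew.ScrewSmoothSectorKSharp` (SCREW column, rung S-P(P1): LEMMA K with the SHARP constant
π² − 1; by the tree's `screwSmoothSectorKCertified_of_sharp` and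
`screwSmoothSectorKTwo_of_certified` the same proof closes the two sibling leaves
`ScrewSmoothSectorKCertified` (8.4924) and `ScrewSmoothSectorKTwo` (structural threshold 2)). For an
admissible generator g (C¹ on [0,1], g(1) = 0, ∫g = 0, ∫g·u^{−1/2} = 0) with lattice profile h(y) =
Σ_{n≤1/y} g(ny), plateau h₀ = −g(0)/2 and sector transform G(w) = −∫₀¹ g′(u)u^w du: K1a (PROFILE
MELLIN FORMULA) the Mellin transform of H := (h − h₀)·1_{(0,1)} − h₀·1_{[1,∞)} on the line Re w =
−1/2 is ζ(w)G(w)/w (Müntz's formula pushed one strip left; the plateau is ζ(0) = −1/2); K1b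
(PARSEVAL + FUNCTIONAL EQUATION) hence ∫₀¹(h − h₀)²y⁻²dy + h₀² = (8π³)⁻¹∫_ℝ |G(−½+it)|²|ζ(3/2+it)|²
dt; K2 (HARDY THREE-POINT BOUND) 2π⁵ g(0)² ≤ ∫_ℝ |G(−½+it)|²|ζ(3/2+it)|² dt, because H(w) :=
G(w)ζ(2+w) lies in H²(Re w > −½) with H(0) = g(0)ζ(2), H(½) = H(1) = 0 and the reproducing-kernel
Gram (Cauchy) matrix C = [1/(aᵢ+aⱼ+1)] at the nodes (0, ½, 1) has det C = 1/5400 and [C⁻¹]₀₀ = 36.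
Then κ(h)·h₀² = (8π³)⁻¹∫|G|²|ζ|² − h₀² ≥ (2π⁵/8π³)g(0)² − h₀² = (π² − 1)h₀² (kernel-checked
composition `kSharp_of`, HOME line1/Sketch.lean, farm rc 0, 0 sorries). No summit is proved by this
line; nothing here bears on the truth of RH.
Lean: `ProfileMellinFormula ∧ ProfileParsevalFE ∧ HardyThreePointBound`

## Assembly
Pure real arithmetic, kernel-checked as `kSharp_of` in HOME line1/Sketch.lean (farm rc 0, 0 sorries;
the proof term of the Assembly item below, landable `--supports` at once): fix admissible g with the
leaf's integrability proviso; K1b (fed by K1a) gives ∫₀¹(h−h₀)²/y² + h₀² = (8π³)⁻¹·X with X the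
weighted boundary energy; if X's integrand is integrable, K2 gives X ≥ 2π⁵g(0)², so ∫₀¹(h−h₀)²/y² ≥
π²g(0)²/4 − h₀² = (π²−1)h₀² (h₀ = −g(0)/2 by `rfl`); if not, the Bochner value X = 0 forces h₀ = 0
and the non-negative left side, and the goal reads (π²−1)·0 ≤ ∫ ≥ 0. The deciding theorem is `closes
(h1a) (h2) (h1b) (hA : Assembly) : ScrewSmoothSectorKSharp := hA h1a h1b h2` (BC1: 4 binders, 3 open
cruxes + the provable-now assembly; every binder consumed).

CLOSES_TARGET: closes rung S-P(P1) of RiemannHypothesis: Summit.RiemannHypothesis.RiemannHypothesis.Theorems.IntegerScrew.ScrewSmoothSectorKSharp (D-0061; not the summit Statement) — the deciding theorem of this route concludes that registered leaf instead of the Statement decl `RiemannHypothesis` (class rung: servable and labelled, never counted as concluding the summit Statement).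

Rationale: WHY THIS LINE. The leaf is the smooth-sector inequality of the floor-constant pencil of the screw
matrices S_M (rh-explicit-screw-matvec-1 gen12 TRIAL-BOUND-THEOREM.md Add. 3, ANATOMY-C-INFINITY.md
§11; typed `Theorems/IntegerScrewSmoothSectorDefs.lean`): CERTIFIED at 8.651 by ball arithmetic (kit
j238785), DERIVED on paper at the sharp constant π² − 1 (rh-explicit-pivot-theory-1 gen18,
HOME/pivot/LEMMA-K-SHARP.md §1), NOT in the kernel and with NO route decomposing it — this line
types that derivation as three obligation Props whose composition is kernel-checked. Mechanism
(operator theory / spectral): the lattice profile is a Beurling–Müntz function, so its Mellin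
transform carries the multiplier ζ(w)/w (Titchmarsh1986 §2.11 (2.11.1), the Nyman–Beurling
dictionary of BaezDuarte2003); Mellin–Plancherel on Re w = −½ and the functional-equation modulus
|ζ(−½+it)|² = (t²+¼)|ζ(3/2+it)|²/(4π²) move the weight to the ZERO-FREE line σ = 3/2; the OUTER
FACTOR ζ(2+w) (bounded with bounded inverse on Re w ≥ −½) absorbs the weight exactly, and the three
admissibility constraints become point evaluations in the Hardy space H²(Re w > −½) (Paley–Wiener,
Rudin1987 Thm 19.2; Rosenblum–Rovnyak 1985 §4.8), where the minimum-norm interpolation problem is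
solved by the 3×3 reproducing-kernel Gram matrix — a Cauchy DETERMINANT (det C = 1/5400, cofactor
1/150, [C⁻¹]₀₀ = 36) is literally where π² − 1 = 36ζ(2)²/π² − 1 comes from. Imported areas:
Hardy-space/RKHS interpolation (Pick–Szegő kernel geometry) and Mellin analysis; what it does that
the listed routes do not: route IntegerScrew consumes LEMMA K only as a certified number (interval
arithmetic through a |ζ(3/2+it)|² MINORANT, which cannot reach the sharp constant), no Theses file
states the Müntz/Hardy mechanism, and the negatives index (4 entries: ShiftedResolvent ×2,
CharacterSums, UniversalFactor) is disjoint from it.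

RANKED CRUXES. #2 ProfileMellinFormula (crux) — (K1a) for every admissible g and every real t, the
Mellin transform (Mathlib `mellin`, ∫₀^∞ y^{w−1}H(y)dy) of the profile function H = (h −
h₀)·1_{(0,1)} − h₀·1_{[1,∞)} at w = −½ + it equals ζ(w)/w · G(w), G(w) = −∫₀¹ g′(u)u^w du — Müntz's
formula (2.11.1) for F = g·1_{[0,1]} (∫F = 0 kills the 1/x-term) continued from 0 < σ < 1 to the
line σ = −½, the plateau h₀ = −g(0)/2 being the residue bookkeeping at w = 0 (ζ(0) = −½) and g(1) =
0 the integration by parts G(w) = w·∫₀¹g(u)u^{w−1}du. [difficulty: L] (why it might fail: the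
continuation to σ = −½ needs h(y) − h₀ = O(y) as y → 0⁺ (Euler–Maclaurin with ∫g = 0, g(1) = 0, g ∈
C¹ up to the boundary) for the Mellin integral to converge absolutely; a mere C⁰ generator or ∫g ≠ 0
breaks it, and a sign/normalisation slip in G makes it false as typed.) [Titchmarsh1986,
BaezDuarte2003,
tree:Summits/RiemannHypothesis/RiemannHypothesis/Theorems/IntegerScrewSmoothSectorDefs.lean]
#3 HardyThreePointBound (crux) — (K2) for every admissible g whose weighted boundary energy t ↦
|G(−½+it)|²|ζ(3/2+it)|² is integrable, 2π⁵·g(0)² ≤ ∫_ℝ |G(−½+it)|²|ζ(3/2+it)|² dt — the minimum-norm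
three-point interpolation bound in H²(Re w > −½) for H = G·ζ(2+·): H(0) = g(0)ζ(2), H(½) = ½ζ(5/2)∫g
u^{−1/2} = 0, H(1) = ζ(3)∫g = 0, Cauchy representation H(a) = (2π)⁻¹∫H(−½+it)/(a+½−it)dt, kernel
Gram matrix C/(2π) with C = [[1,2/3,1/2],[2/3,1/2,2/5],[1/2,2/5,1/3]], hence ‖H‖² ≥ 72π|H(0)|² =
72π·g(0)²·π⁴/36 = 2π⁵g(0)². [difficulty: L] (why it might fail: needs the half-plane Cauchy formula
for H = (Laplace transform of an L² function)·ζ(2+w) — absent from Mathlib — and |ζ(2+w)| ≤ ζ(3/2)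
on Re w ≥ −½; one admissible polynomial g with ratio < 1 (kit j289150 computes it for five) refutes
it and the leaf's sharp constant with it.) [Rudin1987, BaezDuarte2003,
lit:book:rosenblum1985-hardy-classes-operator-theory,
tree:Summits/RiemannHypothesis/RiemannHypothesis/Theorems/IntegerScrewSmoothSectorDefs.lean]
#4 ProfileParsevalFE (crux) — (K1b) for every admissible g with (h − h₀)²/y² integrable on (0,1): IF
the profile Mellin formula K1a holds on the line Re w = −½, THEN ∫₀¹(h − h₀)²y⁻²dy + h₀² =
(8π³)⁻¹∫_ℝ|G(−½+it)|²|ζ(3/2+it)|²dt — Mellin–Plancherel at σ = −½ (∫₀^∞|H|²y⁻²dy =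
(2π)⁻¹∫|𝓜H(−½+it)|²dt, the tail ∫₁^∞h₀²y⁻² = h₀²) and the functional-equation modulus
|ζ(−½+it)|²/|−½+it|² = |ζ(3/2+it)|²/(4π²) (|χ(−½+it)|² = (t²+¼)/(4π²) from Γ-reflection). [deps:
ProfileMellinFormula] [difficulty: M] (why it might fail: Mellin–Plancherel (absent from Mathlib)
needs y^{−3/2}H ∈ L¹∩L²; were the weighted boundary energy not integrable the Bochner right side is
0 and the identity fails unless h₀ = 0 — integrability (∫|G(−½+it)|² = 2π∫g′², |ζ(3/2+it)| ≤ ζ(3/2))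
is part of the burden.) [Titchmarsh1986, Rudin1987, BaezDuarte2003,
tree:Literature/Barriers/RiemannHypothesis/NymanBeurlingObstructions.lean]

TWO-LAYER PLAN. Foreseen glued splits (not filed now): HardyThreePointBound ⇐ (CauchyRepresentation:
H(a) = (2π)⁻¹∫H(−½+it)/(a+½−it)dt for a ∈ {0,½,1}, H = G·ζ(2+·)) → (KernelGram:
∫dt/((a+½+it)(b+½−it)) = 2π/(a+b+1)) → (abstract Gram projection bound with [C⁻¹]₀₀ = 36,
provable-now linear algebra); ProfileMellinFormula ⇐ (Müntz on 0 < σ < 1 for F = g·1_{[0,1]}) →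
(continuation across σ = 0 with the plateau residue) → (absolute convergence at σ = −½ from h − h₀ =
O(y)).

KILL CRITERIA. A refutation of HardyThreePointBound by an explicit admissible g (ratio
∫|G|²|ζ(3/2+it)|²/(2π⁵g(0)²) < 1) closes the route `refuted:HardyThreePointBound` AND retypes the
leaf (then inf κ < π² − 1 and `ScrewSmoothSectorKSharp` is false; `KCertified` 8.4924 survives by
kit j237662); a refutation of ProfileMellinFormula by a normalisation witness (sign of G, the
plateau term, Mathlib's `mellin` convention y^{w−1}) forces a 1:1 restatement, not a pivot; a kernel
proof of `ScrewSmoothSectorKSharp` by any other road (e.g. a certified-numerics port) moots the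
route (superseded).

NOT DECOMPOSED YET. The Cauchy/Paley–Wiener representation inside K2, the Gram-determinant linear
algebra (det C = 1/5400), the O(y) plateau approach inside K1a, and the Plancherel integrability
inside K1b are layer-2 children (see Two-layer plan); the OPTIMALITY half
`ScrewSmoothSectorKOptimal` (no admissible g beats π² − 1; extremal lattice-Jordan profile h* =
ζ(2)h₀Σ_{k<1/y}(J₂(k)/k²)Q(ky)) is deliberately outside this route (not a registered closer).

CHEAPEST FALSIFIER. Compute, for a handful of admissible POLYNOMIAL generators (cubic…sextic;
G(−½+it) is then a finite sum Σ k c_k/(k−½+it) in closed form), the three numbers κ_direct (lattice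
sums), κ_via_K1 = ((8π³)⁻¹X − h₀²)/h₀² and the K2 ratio X/(2π⁵g(0)²) with X =
∫|G(−½+it)|²|ζ(3/2+it)|²dt (Euler–Maclaurin ζ on σ = 3/2, |t| ≤ 2000 + tail): K1 demands κ_direct =
κ_via_K1, K2 demands ratio ≥ 1, the leaf demands κ_direct ≥ π² − 1 = 8.8696. RUN by this seat as kit
job j289150 (script HOME falsify_k2.py, RH-free, 1 core, 145 s, VERDICT: CONSISTENT): cubic (g0 =
−2) κ_direct = 9.77474, κ_via_K1 = 9.77687 (rel 2.2e−4 = t-truncation), K2 ratio 1.09192, leaf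
margin +0.905; quartic c4 = 1: 9.77379 / 9.77591 / 1.09183 / +0.904; quartic c4 = −3: 9.77979 /
9.78194 / 1.09244 / +0.910; quintic: 9.77816 / 9.78030 / 1.09227 / +0.909; sextic: 9.75164 / 9.75373
/ 1.08958 / +0.882 — all five rows pass all three tests (the instrument row that would refute K2 is
`K2 ratio < 1`; none does). Prior evidence: lineage C certified κ ≥ 8.651 (j238785) and Ritz values
8.94–9.05 ≥ 8.8696, pivot-theory-1's quadrature κ(h*) = 8.86954 ± 1e−4 and the Pythagoras check
9.7750 vs 9.7754 on the cubic (LEMMA-K-SHARP.md §1b).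

NUMBERS. π² − 1 = 8.8696044 (sharp, DERIVED); certified 8.4924 (kit j237662), 8.651 (kit j238785);
structural threshold 2; Cauchy matrix C = [[1,2/3,1/2],[2/3,1/2,2/5],[1/2,2/5,1/3]], det C = 1/5400,
[C⁻¹]₀₀ = 36, first row of C⁻¹ = (36, −120, 90); |χ(−½+it)|² = (t²+¼)/(4π²); ζ(2) = π²/6 (Mathlib
`riemannZeta_two`); bounds ζ(3)/ζ(3/2) ≤ |ζ(σ+it)| ≤ ζ(3/2) on σ ≥ 3/2.

DEFINITION REQUESTS. None: the three Props are spelled over `latticeProfile`, `latticePlateau`,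
`SmoothSectorAdmissible` (tree), Mathlib `mellin`, `riemannZeta`, `deriv`, set integrals; a later
convenience definition `sectorTransform g w := −∫₀¹ g′(u)u^w du` (topic
Summits/RiemannHypothesis/RiemannHypothesis/Theorems) would shorten the statements but is not
needed.

Novelty: Searches (2026-08-27): `lit search --hybrid "Müntz formula Mellin transform zeta lattice sum
Titchmarsh"` (6 docs; hit [corpus:book:titchmarsh1986-theory-riemann-zeta-function-2nd-ed-revised
p.24] = §2.11 (2.11.1), 0 < σ < 1); `lit search --hybrid "minimum norm interpolation Hardy space
half-plane reproducing kernel Cauchy matrix"` (6 docs; nearest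
[corpus:book:rosenblum1985-hardy-classes-operator-theory pp.29–48, 88] Pick–Nevanlinna interpolation
and the Paley–Wiener representation Thm E); `rg SmoothSectorK|latticeProfile lean/Summits/…/Theses`
(0 route files); `ledger negatives --problem RiemannHypothesis` (4 entries, none on lattice
profiles); galaxy queries logged in NOTES.md.
Nearest prior art found: rh-explicit-pivot-theory-1 gen18 HOME/pivot/LEMMA-K-SHARP.md §1 (the paper
derivation this route types; its own nearest art is lineage C's minorant relaxation
TRIAL-BOUND-THEOREM.md Add. 3 (vii), certified 8.651) and the Nyman–Beurling Mellin/Hardy dictionary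
of BaezDuarte2003 / BDBLS2000
(`Literature/Barriers/RiemannHypothesis/NymanBeurlingObstructions.lean`), which treats ∑c_kρ(θ_k/x)
with the multiplier ζ(s)/s on the CRITICAL strip.
Delta: the same Müntz/Hardy dictionary run on the zero-free side σ ≥ 3/2 with the outer factor
ζ(2+w), turning a certified-numerics leaf into three typed analytic lemmas whose composition is
kernel-checked — new as a ROUTE (no Theses file carries it), known as mathematics (variant).
Claimed grade: variant  [refs: book:titchmarsh1986-theory-riemann-zeta-function-2nd-ed-revised, book:rosenblum1985-hardy-classes-operator-theory, BaezDuarte2003, BDBLS2000]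

Barriers (technique_class: hardy-interpolation, mellin-plancherel, muntz): - technique_class: hardy-interpolation, mellin-plancherel, muntz
- Literature.Barriers.RiemannHypothesis.NymanBeurlingObstructions: does not apply — those no-go
facts (BaezDuarte2000 Prop 4.4/4.7, BDBLS2000) bound approximation of χ by Beurling functions in
L²(0,∞), i.e. live on the critical strip where ζ(w)/w has zeros; this line's Hardy space sits over
Re w ≥ −½ ↔ σ = 2 + Re w ≥ 3/2, where ζ(2+w) is outer (bounded, boundedly invertible), so no
Blaschke/zero obstruction enters (lineage C's first attempt factored through ζ(1−w) and met exactly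
that obstruction, «κ = 3»).
- Literature.Barriers.RiemannHypothesis.MollifierLimitations: does not apply — no mollification of ζ
on or near the critical line; the weight |ζ(3/2+it)|² is absorbed exactly by an outer factor, not
approximated.
- rh-split BARRIER letters B1–B21 / `riemannHypothesis_iff_weilGroundEnergy_bddBelow` (slack ⇒ RH):
do not apply — the leaf is an RH-FREE inequality about lattice sums of C¹ functions (no zero of ζ
enters; ζ only on σ ≥ 3/2), labelled RH-FREE in its Defs file; the line claims nothing about S_M's
bottom eigenvalue beyond what lineage C's RH-conditional pencil already consumes.
- Negatives index: 4 refuted statements (ShiftedResolvent ResolventVectorExists/ResolventRealZeros,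
CharacterSums ConreyPositivity, UniversalFactor LaplaceLoophole) — disjoint vocabulary; nothing here
restates them.

History (route lifecycle, newest last):
- 2026-08-27T21:42:36Z · rev 1: restated ProfileMellinFormula (stmt-RiemannHypothesis-21565) — repair (pre-emptive, refuter checklist 4c(ii) Bochner junk; flagged by rh-idea-5 SKETCH-21612-K1.md §1): K1a now carries the hypothesis MellinConvergent H (−1/2 (planner-rh-idea-6-g0-0)
- 2026-08-27T21:42:53Z · rev 1: restated ProfileParsevalFE (stmt-RiemannHypothesis-21567) — repair step 2/2: K1b ProfileParsevalFE now takes K1a (ProfileMellinFormula, restated with the MellinConvergent proviso) as a GLOBAL hypothesis instead of the pe (planner-rh-idea-6-g0-0)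
- 2026-08-29T23:18:34Z · CLOSED proved — proved:Summit.RiemannHypothesis.RiemannHypothesis.Theorems.ScrewLemmaKCoprofile.screwSmoothSectorKSharp (operator:999:1248457)

sub-problem: RiemannHypothesis · status: closed(proved) · opened planner-rh-idea-6-g0-0 2026-08-27T20:14:06Z · rev 2 · ledger route-RiemannHypothesis-SmoothSectorHardy
GENERATED by the gate from the ledger (D-0016/17). Provers cite these decls: `theorem foo : Summit.RiemannHypothesis.RiemannHypothesis.Theses.SmoothSectorHardy.<Decl> := …` in Summits/RiemannHypothesis/RiemannHypothesis/Theorems/<Name>.lean.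
-/

namespace Summit.RiemannHypothesis.RiemannHypothesis.Theses.SmoothSectorHardy

open scoped BigOperators Topology Manifold Classical MeasureTheory ProbabilityTheory Matrix InnerProductSpace ComplexConjugate ContinuousMap
open Filter Set Function TopologicalSpace MeasureTheory

attribute [summit_statement] _root_.Summit.RiemannHypothesis
attribute [summit_statement] _root_.Summit.RiemannHypothesis.RiemannHypothesis.Theorems.IntegerScrew.ScrewSmoothSectorKSharp

open Summit

-- earlier ProfileMellinFormula (stmt-RiemannHypothesis-21565, replaced 2026-08-27T21:42:36Z -> stmt-RiemannHypothesis-22982): retired by None — ∀ g : ℝ → ℝ, Summit.RiemannHypothesis.RiemannHypothesis.Theorems.IntegerScrew.SmoothSectorAdmissible g → ∀ t : ℝ, mellin (fun y : ℝ => (((Set.Ioo (0:ℝ) 1).indicator (fun y => Summit.RiemannHypothesis.RiemannHypothesis.Theorems.IntegerScrew.latticeProfile g y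
/-- item stmt-RiemannHypothesis-22982 · crux · rank 2 · closed · proved by Summit.RiemannHypothesis.RiemannHypothesis.Theorems.SmoothSectorHardy.profileMellinFormula_proof (prover) · by planner
why it might fail: even with the absolute-convergence proviso the continuation identity on Re w = −1/2 needs the Müntz formula for C¹ data plus dominated convergence to the boundary line; a sign/normalisation slip in G(w) = w∫g u^{w−1} (IBP with g(1)=0) would make it false for every g
sources: BaezDuarte2003, tree:Literature/NumberTheory/LFunctions/MuentzFormula.lean, pub/ideators/rh-idea-5/SKETCH-21612-K1.md
[crux] (K1a) for every admissible g and every real t, the Mellin transform (Mathlib `mellin`, ∫₀^∞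
y^{w−1}H(y)dy) of the profile function H = (h − h₀)·1_{(0,1)} − h₀·1_{[1,∞)} at w = −½ + it equals
ζ(w)/w · G(w), G(w) = −∫₀¹ g′(u)u^w du — Müntz's formula (2.11.1) for F = g·1_{[0,1]} (∫F = 0 kills
the 1/x-term) continued from 0 < σ < 1 to the line σ = −½, the plateau h₀ = −g(0)/2 being the
residue bookkeeping at w = 0 (ζ(0) = −½) and g(1) = 0 the integration by parts G(w) =
w·∫₀¹g(u)u^{w−1}du. [difficulty: L] -/
@[route_item "route-RiemannHypothesis-SmoothSectorHardy", crux]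
def ProfileMellinFormula : Prop :=
  ∀ g : ℝ → ℝ, Summit.RiemannHypothesis.RiemannHypothesis.Theorems.IntegerScrew.SmoothSectorAdmissible g → ∀ t : ℝ, MellinConvergent (fun y : ℝ => (((Set.Ioo (0:ℝ) 1).indicator (fun y => Summit.RiemannHypothesis.RiemannHypothesis.Theorems.IntegerScrew.latticeProfile g y - Summit.RiemannHypothesis.RiemannHypothesis.Theorems.IntegerScrew.latticePlateau g) y - (Set.Ici (1:ℝ)).indicator (fun _ => Summit.RiemannHypothesis.RiemannHypothesis.Theorems.IntegerScrew.latticePlateau g) y : ℝ) : ℂ)) (-(1 / 2 : ℂ) + t * Complex.I) → mellin (fun y : ℝ => (((Set.Ioo (0:ℝ) 1).indicator (fun y => Summit.RiemannHypothesis.RiemannHypothesis.Theorems.IntegerScrew.latticeProfile g y - Summit.RiemannHypothesis.RiemannHypothesis.Theorems.IntegerScrew.latticePlateau g) y - (Set.Ici (1:ℝ)).indicator (fun _ => Summit.RiemannHypothesis.RiemannHypothesis.Theorems.IntegerScrew.latticePlateau g) y : ℝ) : ℂ)) (-(1 / 2 : ℂ) + t * Complex.I) = riemannZeta (-(1 /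 2 : ℂ) + t * Complex.I) / (-(1 / 2 : ℂ) + t * Complex.I) * -(∫ u in Set.Ioo (0:ℝ) 1, ((deriv g u : ℝ) : ℂ) * (u : ℂ) ^ (-(1 / 2 : ℂ) + t * Complex.I))

-- `ProfileMellinFormula` holds: proved by `Summit.RiemannHypothesis.RiemannHypothesis.Theorems.SmoothSectorHardy.profileMellinFormula_proof` (its module imports this route file, so no `_holds` link can be stated here).

/-- item stmt-RiemannHypothesis-21566 · crux · rank 3 · closed · proved by Summit.RiemannHypothesis.RiemannHypothesis.Theorems.SmoothSectorHardy.hardyThreePointBound_proof (prover) · by planner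
why it might fail: needs the half-plane Cauchy formula for H = (Laplace transform of an L² function)·ζ(2+w) — absent from Mathlib — and |ζ(2+w)| ≤ ζ(3/2) on Re w ≥ −½; one admissible polynomial g with ratio < 1 (kit j289150 computes it for five) refutes it and the leaf's sharp constant with it.
sources: Rudin1987, BaezDuarte2003, lit:book:rosenblum1985-hardy-classes-operator-theory, tree:Summits/RiemannHypothesis/RiemannHypothesis/Theorems/IntegerScrewSmoothSectorDefs.lean
[crux] (K2) for every admissible g whose weighted boundary energy t ↦ |G(−½+it)|²|ζ(3/2+it)|² is
integrable, 2π⁵·g(0)² ≤ ∫_ℝ |G(−½+it)|²|ζ(3/2+it)|² dt — the minimum-norm three-point interpolation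
bound in H²(Re w > −½) for H = G·ζ(2+·): H(0) = g(0)ζ(2), H(½) = ½ζ(5/2)∫g u^{−1/2} = 0, H(1) =
ζ(3)∫g = 0, Cauchy representation H(a) = (2π)⁻¹∫H(−½+it)/(a+½−it)dt, kernel Gram matrix C/(2π) with
C = [[1,2/3,1/2],[2/3,1/2,2/5],[1/2,2/5,1/3]], hence ‖H‖² ≥ 72π|H(0)|² = 72π·g(0)²·π⁴/36 = 2π⁵g(0)².
[difficulty: L] -/
@[route_item "route-RiemannHypothesis-SmoothSectorHardy", crux]
def HardyThreePointBound : Prop :=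
  ∀ g : ℝ → ℝ, Summit.RiemannHypothesis.RiemannHypothesis.Theorems.IntegerScrew.SmoothSectorAdmissible g → MeasureTheory.Integrable (fun t : ℝ => ‖∫ u in Set.Ioo (0:ℝ) 1, ((deriv g u : ℝ) : ℂ) * (u : ℂ) ^ (-(1 / 2 : ℂ) + t * Complex.I)‖ ^ 2 * ‖riemannZeta (3 / 2 + t * Complex.I)‖ ^ 2) → 2 * Real.pi ^ 5 * (g 0) ^ 2 ≤ ∫ t : ℝ, ‖∫ u in Set.Ioo (0:ℝ) 1, ((deriv g u : ℝ) : ℂ) * (u : ℂ) ^ (-(1 / 2 : ℂ) + t * Complex.I)‖ ^ 2 * ‖riemannZeta (3 / 2 + t * Complex.I)‖ ^ 2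

-- `HardyThreePointBound` holds: proved by `Summit.RiemannHypothesis.RiemannHypothesis.Theorems.SmoothSectorHardy.hardyThreePointBound_proof` (its module imports this route file, so no `_holds` link can be stated here).

-- earlier ProfileParsevalFE (stmt-RiemannHypothesis-21567, replaced 2026-08-27T21:42:53Z -> stmt-RiemannHypothesis-22983): retired by None — ∀ g : ℝ → ℝ, Summit.RiemannHypothesis.RiemannHypothesis.Theorems.IntegerScrew.SmoothSectorAdmissible g → MeasureTheory.IntegrableOn (fun y => (Summit.RiemannHypothesis.RiemannHypothesis.Theorems.IntegerScrew.latticeProfile g y - Summit.RiemannHypothesis.Riemann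
/-- item stmt-RiemannHypothesis-22983 · crux · rank 4 · closed · proved by Summit.RiemannHypothesis.RiemannHypothesis.Theorems.SmoothSectorHardy.profileParsevalFE_proof (prover) · by planner
why it might fail: the identity must now be delivered for ALL C¹-admissible g from the line formula only where it converges absolutely (C², BV g′): needs the density step ‖Φ_g‖₂ ≤ ζ(3/2)·sup|g′| and L²(y⁻²dy)-continuity of both sides; the 1/(8π³) normalisation could be off by the Plancherel 2π
sources: BaezDuarte2003, tree:Literature/Analysis/FunctionSpaces/PlancherelL1L2.lean, pub/ideators/rh-idea-5/SKETCH-21612-K1.md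
[crux] (K1b) for every admissible g with (h − h₀)²/y² integrable on (0,1): IF the profile Mellin
formula K1a holds on the line Re w = −½, THEN ∫₀¹(h − h₀)²y⁻²dy + h₀² =
(8π³)⁻¹∫_ℝ|G(−½+it)|²|ζ(3/2+it)|²dt — Mellin–Plancherel at σ = −½ (∫₀^∞|H|²y⁻²dy =
(2π)⁻¹∫|𝓜H(−½+it)|²dt, the tail ∫₁^∞h₀²y⁻² = h₀²) and the functional-equation modulus
|ζ(−½+it)|²/|−½+it|² = |ζ(3/2+it)|²/(4π²) (|χ(−½+it)|² = (t²+¼)/(4π²) from Γ-reflection). [deps: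
ProfileMellinFormula] [difficulty: M] -/
@[route_item "route-RiemannHypothesis-SmoothSectorHardy", crux]
def ProfileParsevalFE : Prop :=
  Summit.RiemannHypothesis.RiemannHypothesis.Theses.SmoothSectorHardy.ProfileMellinFormula → ∀ g : ℝ → ℝ, Summit.RiemannHypothesis.RiemannHypothesis.Theorems.IntegerScrew.SmoothSectorAdmissible g → MeasureTheory.IntegrableOn (fun y => (Summit.RiemannHypothesis.RiemannHypothesis.Theorems.IntegerScrew.latticeProfile g y - Summit.RiemannHypothesis.RiemannHypothesis.Theorems.IntegerScrew.latticePlateau g) ^ 2 / y ^ 2) (Set.Ioo 0 1) → (∫ y in Set.Ioo (0:ℝ) 1, (Summit.RiemannHypothesis.RiemannHypothesis.Theorems.IntegerScrew.latticeProfile g y - Summit.RiemannHypothesis.RiemannHypothesis.Theorems.IntegerScrew.latticePlateau g) ^ 2 / y ^ 2) + Summit.RiemannHypothesis.RiemannHypothesis.Theorems.IntegerScrew.latticePlateau g ^ 2 = (1 / (8 * Real.pi ^ 3)) * ∫ t : ℝ, ‖∫ u in Set.Ioo (0:ℝ) 1, ((deriv g u : ℝ) : ℂ) * (u : ℂ)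 ^ (-(1 / 2 : ℂ) + t * Complex.I)‖ ^ 2 * ‖riemannZeta (3 / 2 + t * Complex.I)‖ ^ 2

-- `ProfileParsevalFE` holds: proved by `Summit.RiemannHypothesis.RiemannHypothesis.Theorems.SmoothSectorHardy.profileParsevalFE_proof` (its module imports this route file, so no `_holds` link can be stated here).

/-- item stmt-RiemannHypothesis-21568 · assembly · rank 1 · closed · proved by Summit.RiemannHypothesis.RiemannHypothesis.Theorems.SmoothSectorHardy.assembly_holds (prover) · by planner
sources: tree:Summits/RiemannHypothesis/RiemannHypothesis/Theorems/IntegerScrewSmoothSectorDefs.lean, Rudin1987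
[assembly] ProfileMellinFormula → ProfileParsevalFE → HardyThreePointBound → the rung leaf
ScrewSmoothSectorKSharp (LEMMA K with constant π² − 1); PROVABLE NOW — its proof is `kSharp_of` of
the sketch (by_cases on integrability of the weighted boundary energy, `integral_undef`,
`setIntegral_nonneg`, `field_simp`, `nlinarith`). -/
@[route_item "route-RiemannHypothesis-SmoothSectorHardy", crux]
def Assembly : Prop :=
  ProfileMellinFormula → ProfileParsevalFE → HardyThreePointBound → Summit.RiemannHypothesis.RiemannHypothesis.Theorems.IntegerScrew.ScrewSmoothSectorKSharp

-- `Assembly` holds: proved by `Summit.RiemannHypothesis.RiemannHypothesis.Theorems.SmoothSectorHardy.assembly_holds` (its module imports this route file, so no `_holds` link can be stated here).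

/-! D-0027 §2.1 — DECIDING THEOREM (planner-authored via `route open/edit --closes-file`; by planner-rh-idea-6-g0-0 2026-08-27T20:14:07Z) — ARCHIVED: route closed (proved) 2026-08-29T23:18:34Z; kept so importers keep building:
its hypotheses are this route's items and its conclusion the registered leaf `Summit.RiemannHypothesis.RiemannHypothesis.Theorems.IntegerScrew.ScrewSmoothSectorKSharp` (rung S-P(P1), D-0061) (glue_lint), and it elaborates with this file. -/

-- glue.lean — DECIDING THEOREM of route SmoothSectorHardy (D-0027 §2.1; D-0061 rung shape: concludes the RUNG LEAF
-- `Summit.RiemannHypothesis.RiemannHypothesis.Theorems.IntegerScrew.ScrewSmoothSectorKSharp` («LEMMA K, sharp constant π² − 1»,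
-- RH-FREE, registered closer rung S-P(P1)) BY NAME).  Hypotheses = the three crux decls + the Assembly item (provable now: its
-- proof is `kSharp_of` in the seat's Sketch.lean, farm rc 0 / 0 sorries); every binder is consumed (BC1: 4 binders, 3 open cruxes).
@[closes "route-RiemannHypothesis-SmoothSectorHardy"] theorem closes (h1a : ProfileMellinFormula) (h2 : HardyThreePointBound) (h1b : ProfileParsevalFE)
    (hA : Assembly) : Summit.RiemannHypothesis.RiemannHypothesis.Theorems.IntegerScrew.ScrewSmoothSectorKSharp :=
  hA h1a h1b h2

end Summit.RiemannHypothesis.RiemannHypothesis.Theses.SmoothSectorHardy
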